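import Literature.AlgebraicGeometry.HodgeTheory.CyclicReflectionComplexification
import HarnessLib

/-!
# Restricting a group of automorphisms to invariant subspaces: `Γ → GL(P)` and `Γ → Π_i GL(E_i)`
# (Katz's projections `ρ_i`; Carlson–Toledo's `U → PU`) — lane D packaging, part 6c

Family `hodge`, layer `Literature/AlgebraicGeometry/HodgeTheory`. DEFINITIONS + simp lemmas (apparatus).
Sequel of the tree's `submoduleStabilizer` / `restrictEnd` (`UnitaryReflectionPairInfinite`), for crux K1 of
`Summits/HodgeConjecture/HodgeConjecture/Theses/CyclicUnitaryPowers.lean` (lane D glue): the Goursat–Kolchin–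
Ribet criterion (`Katz1990_goursatKolchinRibet_specialLinear'`) is stated for a subgroup
`H ≤ Π_i GL(E_i)` and its projections `H.map (Pi.evalMonoidHom _ i)`; the monodromy group `Γ ⊗ ℂ ≤ GL(V ⊗ ℂ)`
preserves the eigenspaces `E_j = H(ζ^j)` of the deck transformation, and `H` is its image under the
product of the restriction homomorphisms defined here.

* `restrictLinearEquiv P g hg : P ≃ₗ[K] P` — an automorphism stabilising `P`, restricted to `P`;
* `restrictEquivHom P Γ hΓ : Γ →* (P ≃ₗ[K] P)` — for a subgroup stabilising `P` (the units version of the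
  tree's `restrictEnd`, `coe_restrictEquivHom_eq_restrictEnd`);
* `piRestrictHom E Γ hΓ : Γ →* Π i, (E i ≃ₗ[K] E i)` — for a family of stabilised subspaces (Katz's
  `H ↦ (ρ_i(H))_i`), with `map_piRestrictHom_map_eval` identifying the `i`-th projection of the image with the
  image of the `i`-th restriction;
* `map_glBaseChangeHom_le_submoduleStabilizer_eigenspace` — `Γ ⊗ ℂ` stabilises every eigenspace of
  `τ ⊗ ℂ` when `Γ` commutes with `τ`.
Written by the prover seat `hodge-nonav-prover-Ax`.

## References
* [Katz1990ESDE] N. M. Katz, *Exponential Sums and Differential Equations*, Annals of Math. Studies 124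
  (1990), §1.8 ("`ρ_i : G → GL(V_i)` the `i`-th projection"), Prop. 1.8.2.
* [CarlsonToledo1999] J. A. Carlson, D. Toledo, Duke Math. J. 97 (1999), §7 Lemma (p. 15) ("the natural map
  `U → PU`"), §2 (p. 5).
-/

noncomputable section

open Module Literature.AlgebraicGeometry.Motives
open scoped TensorProduct

namespace Literature.AlgebraicGeometry.HodgeTheory

/-! ### §1 One invariant subspace -/

section One

universe u v

variable {K : Type u} [Field K] {W : Type v} [AddCommGroup W] [Module K W]

/-- An automorphism `g` mapping `P` onto itself (`g ∈ submoduleStabilizer P`), restricted to a linear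
automorphism of `P`. [cite: Katz1990ESDE, §1.8 Prop. 1.8.2] -/
def restrictLinearEquiv (P : Submodule K W) (g : W ≃ₗ[K] W) (hg : g ∈ submoduleStabilizer P) : P ≃ₗ[K] P where
  toFun x := ⟨g x, (hg x).mp x.2⟩
  map_add' x y := Subtype.ext (by simp)
  map_smul' a x := Subtype.ext (by simp)
  invFun x := ⟨g.symm x, (hg (g.symm x)).mpr (by simp)⟩
  left_inv x := Subtype.ext (g.symm_apply_apply x)
  right_inv x := Subtype.ext (g.apply_symm_apply x)

/-- [cite: Katz1990ESDE, §1.8 Prop. 1.8.2] -/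
@[simp] theorem restrictLinearEquiv_apply_coe (P : Submodule K W) (g : W ≃ₗ[K] W)
    (hg : g ∈ submoduleStabilizer P) (x : P) : ((restrictLinearEquiv P g hg x : P) : W) = g x := rfl

/-- [cite: Katz1990ESDE, §1.8 Prop. 1.8.2] -/
@[simp] theorem restrictLinearEquiv_symm_apply_coe (P : Submodule K W) (g : W ≃ₗ[K] W)
    (hg : g ∈ submoduleStabilizer P) (x : P) : (((restrictLinearEquiv P g hg).symm x : P) : W) = g.symm x := rfl

/-- **Restriction homomorphism `Γ →* GL(P)`** for a subgroup `Γ ≤ GL(W)` stabilising `P` (Katz's projection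
`ρ_i`, Carlson–Toledo's `U → GL(V_i)`; the automorphism-valued version of the tree's `restrictEnd`).
[cite: Katz1990ESDE, §1.8 Prop. 1.8.2] [cite: CarlsonToledo1999, §7 Lemma Ulemma (p. 15 L67–69)] -/
def restrictEquivHom (P : Submodule K W) (Γ : Subgroup (W ≃ₗ[K] W)) (hΓ : Γ ≤ submoduleStabilizer P) :
    Γ →* (P ≃ₗ[K] P) where
  toFun g := restrictLinearEquiv P g.1 (hΓ g.2)
  map_one' := LinearEquiv.ext fun _ => Subtype.ext rfl
  map_mul' _ _ := LinearEquiv.ext fun _ => Subtype.ext rfl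

/-- [cite: Katz1990ESDE, §1.8 Prop. 1.8.2] -/
@[simp] theorem restrictEquivHom_apply_coe (P : Submodule K W) (Γ : Subgroup (W ≃ₗ[K] W))
    (hΓ : Γ ≤ submoduleStabilizer P) (g : Γ) (x : P) : ((restrictEquivHom P Γ hΓ g x : P) : W) = g.1 x := rfl

/-- The underlying endomorphism of `restrictEquivHom` is the tree's `restrictEnd`.
[cite: CarlsonToledo1999, §7 Lemma Ulemma (p. 15 L67–69)] -/
theorem coe_restrictEquivHom_eq_restrictEnd (P : Submodule K W) (Γ : Subgroup (W ≃ₗ[K] W))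
    (hΓ : Γ ≤ submoduleStabilizer P) (g : Γ) :
    ((restrictEquivHom P Γ hΓ g : P ≃ₗ[K] P) : P →ₗ[K] P) = restrictEnd P Γ hΓ g :=
  LinearMap.ext fun _ => Subtype.ext rfl

/-- Two automorphisms of `P`-stabilising type with the same action on `P` have the same restriction — in
particular the restriction only depends on the values on `P`. [cite: Katz1990ESDE, §1.8 Prop. 1.8.2] -/
theorem restrictLinearEquiv_eq_of_eqOn (P : Submodule K W) {g g' : W ≃ₗ[K] W} (hg : g ∈ submoduleStabilizer P)
    (hg' : g' ∈ submoduleStabilizer P) (h : ∀ x ∈ P, g x = g' x) :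
    restrictLinearEquiv P g hg = restrictLinearEquiv P g' hg' :=
  LinearEquiv.ext fun x => Subtype.ext (h x x.2)

end One

/-! ### §2 A family of invariant subspaces: `Γ →* Π_i GL(E_i)` -/

section Family

universe u v w

variable {K : Type u} [Field K] {W : Type v} [AddCommGroup W] [Module K W] {ι : Type w}

/-- **The product of the restrictions `Γ →* Π_i GL(E_i)`** for a subgroup stabilising each `E_i` (Katz:
`H ≤ Π_i GL(V_i)` "with projections `ρ_i`"). [cite: Katz1990ESDE, §1.8 Prop. 1.8.2] -/
def piRestrictHom (E : ι → Submodule K W) (Γ : Subgroup (W ≃ₗ[K] W)) (hΓ : ∀ i, Γ ≤ submoduleStabilizer (E i)) :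
    Γ →* Π i, (E i ≃ₗ[K] E i) :=
  MonoidHom.pi fun i => restrictEquivHom (E i) Γ (hΓ i)

/-- [cite: Katz1990ESDE, §1.8 Prop. 1.8.2] -/
@[simp] theorem piRestrictHom_apply (E : ι → Submodule K W) (Γ : Subgroup (W ≃ₗ[K] W))
    (hΓ : ∀ i, Γ ≤ submoduleStabilizer (E i)) (g : Γ) (i : ι) :
    piRestrictHom E Γ hΓ g i = restrictEquivHom (E i) Γ (hΓ i) g := rfl

/-- [cite: Katz1990ESDE, §1.8 Prop. 1.8.2] -/
theorem piRestrictHom_apply_coe (E : ι → Submodule K W) (Γ : Subgroup (W ≃ₗ[K] W))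
    (hΓ : ∀ i, Γ ≤ submoduleStabilizer (E i)) (g : Γ) (i : ι) (x : E i) :
    ((piRestrictHom E Γ hΓ g i x : E i) : W) = g.1 x := rfl

/-- The `i`-th projection composed with the product of restrictions is the `i`-th restriction.
[cite: Katz1990ESDE, §1.8 Prop. 1.8.2] -/
theorem evalMonoidHom_comp_piRestrictHom (E : ι → Submodule K W) (Γ : Subgroup (W ≃ₗ[K] W))
    (hΓ : ∀ i, Γ ≤ submoduleStabilizer (E i)) (i : ι) :
    (Pi.evalMonoidHom (fun i => E i ≃ₗ[K] E i) i).comp (piRestrictHom E Γ hΓ) = restrictEquivHom (E i) Γ (hΓ i) :=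
  MonoidHom.ext fun _ => rfl

/-- **Katz's `ρ_i(H)` for `H = ` the image of `Γ`**: the `i`-th projection of the image of a subgroup
`Γ₀ ≤ Γ` in `Π_i GL(E_i)` is the image of `Γ₀` under the `i`-th restriction.
[cite: Katz1990ESDE, §1.8 Prop. 1.8.2] -/
theorem map_piRestrictHom_map_eval (E : ι → Submodule K W) (Γ : Subgroup (W ≃ₗ[K] W))
    (hΓ : ∀ i, Γ ≤ submoduleStabilizer (E i)) (Γ₀ : Subgroup Γ) (i : ι) :
    (Γ₀.map (piRestrictHom E Γ hΓ)).map (Pi.evalMonoidHom (fun i => E i ≃ₗ[K] E i) i) =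
      Γ₀.map (restrictEquivHom (E i) Γ (hΓ i)) := by
  rw [Subgroup.map_map, evalMonoidHom_comp_piRestrictHom]

end Family

/-! ### §3 The complexified monodromy group stabilises the eigenspaces of `τ ⊗ ℂ` -/

section Eigen

universe v

variable {V : Type v} [AddCommGroup V] [Module ℚ V] [Module.Finite ℚ V]

/-- **`Γ ⊗ ℂ ≤ Stab(H(μ))`**: if every element of `Γ ≤ GL_ℚ(V)` commutes with `τ`, the base-changed group
`Γ.map glBaseChangeHom ≤ GL_ℂ(V ⊗ ℂ)` stabilises every eigenspace `H(μ)` of `τ ⊗ ℂ` ("a linear map commutes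
with `σ` if and only if it preserves the eigenspace decomposition"). [cite: CarlsonToledo1999, §2 (p. 5)] -/
theorem map_glBaseChangeHom_le_submoduleStabilizer_eigenspace {τ : V →ₗ[ℚ] V} {Γ : Subgroup (V ≃ₗ[ℚ] V)}
    (hΓ : ∀ γ ∈ Γ, ∀ x, γ (τ x) = τ (γ x)) (μ : ℂ) :
    Γ.map (glBaseChangeHom ℚ ℂ V) ≤ submoduleStabilizer (Module.End.eigenspace (τ.baseChange ℂ) μ) := by
  rintro _ ⟨γ, hγ, rfl⟩
  refine glBaseChangeHom_mem_submoduleStabilizer_eigenspace (LinearMap.ext fun x => ?_) μ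
  simpa using hΓ γ hγ x

/-- The restriction of `γ ⊗ ℂ` (`γ ∈ Γ`, `Γ` commuting with `τ`) to `H(μ)`, evaluated: it is `γ ⊗ ℂ`.
[cite: CarlsonToledo1999, §2 (p. 5)] -/
theorem restrictEquivHom_glBaseChangeHom_apply_coe {τ : V →ₗ[ℚ] V} {Γ : Subgroup (V ≃ₗ[ℚ] V)}
    (hΓ : ∀ γ ∈ Γ, ∀ x, γ (τ x) = τ (γ x)) (μ : ℂ) (g : Γ.map (glBaseChangeHom ℚ ℂ V))
    (x : Module.End.eigenspace (τ.baseChange ℂ) μ) :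
    ((restrictEquivHom _ _ (map_glBaseChangeHom_le_submoduleStabilizer_eigenspace hΓ μ) g x :
      Module.End.eigenspace (τ.baseChange ℂ) μ) : ℂ ⊗[ℚ] V) = g.1 x := rfl

/-- **Unitarity of the restrictions**: for `γ ∈ Γ` a `B`-isometry commuting with `τ`, the restriction of
`γ ⊗ ℂ` to `H(μ)` preserves the restricted hermitian form `h|H(μ)` (`LinearMap.domRestrict₁₂`).
[cite: CarlsonToledo1999, §2 (p. 5) and §5 (p. 11)] -/
theorem restrictEquivHom_unitary {τ : V →ₗ[ℚ] V} {Γ : Subgroup (V ≃ₗ[ℚ] V)} {B : LinearMap.BilinForm ℚ V}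
    (hΓ : ∀ γ ∈ Γ, ∀ x, γ (τ x) = τ (γ x)) (hΓB : ∀ γ ∈ Γ, ∀ x y, B (γ x) (γ y) = B x y) (μ : ℂ)
    (g : Γ.map (glBaseChangeHom ℚ ℂ V)) (x y : Module.End.eigenspace (τ.baseChange ℂ) μ) :
    (hermitianOfBilin B).domRestrict₁₂ _ _
        (restrictEquivHom _ _ (map_glBaseChangeHom_le_submoduleStabilizer_eigenspace hΓ μ) g x)
        (restrictEquivHom _ _ (map_glBaseChangeHom_le_submoduleStabilizer_eigenspace hΓ μ) g y) =
      (hermitianOfBilin B).domRestrict₁₂ _ _ x y := by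
  obtain ⟨_, ⟨γ, hγ, rfl⟩⟩ := g
  simp only [LinearMap.domRestrict₁₂_apply, restrictEquivHom_apply_coe]
  exact hermitianOfBilin_glBaseChangeHom (hΓB γ hγ) x y

end Eigen

end Literature.AlgebraicGeometry.HodgeTheory

end
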